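import Summits.QuantumFields.YangMills.Theorems.WilsonVillainDualStiffnessHartmanWatsonMixtureTail
import Summits.QuantumFields.YangMills.Theses.WilsonVillainDualStiffness
import Summits.QuantumFields.YangMills.Theses.WilsonVillainPerimeterTransfer
import HarnessLib

/-!
# Shared crux stmt-QuantumFields-26809 `HartmanWatsonMixture` (routes `WilsonVillainDualStiffness` child 2 /
# `WilsonVillainPerimeterTransfer` r4) — CLOSED MODULO the named fact `HartmanWatsonLaw` (Hartman–Watson 1974 / Yor 1980)

With both analysis stubs of the registered skeleton v2 landed (`ArcMass.stub_arcMassLowerBound` p659513,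
`Tail.stub_tailFromArcBound` p660236), the skeleton's remaining stub `stub_mixingMeasureExists` is — as the planner typed it —
exactly the EXISTENCE half of the Hartman–Watson theorem, i.e. the tree's named fact
`Literature.Probability.HartmanWatson1974.HartmanWatsonLaw : ∀ β > 0, ∃ η, IsMixingMeasure β η` (`VonMisesMixture.lean`; not proved
in the tree: positivity of Yor's density).  This file records the two compositions:

* `stub_mixingMeasureExists_of_law` — `HartmanWatsonLaw →` the registered stub signature VERBATIM (the item's moment clause is
  `IsMixingMeasure.laplace` read through `latticeModels_besselI_eq_besselI_natAbs` + evenness of `cos`);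
* **`hartmanWatsonMixture_of_law`** — `HartmanWatsonLaw → Theses.WilsonVillainDualStiffness.HartmanWatsonMixture` (the crux decl BY
  NAME, `c₀ := 2/5`, `β₀ := max 200 0`), and its character-identical twin `hartmanWatsonMixture_of_law'` for
  `Theses.WilsonVillainPerimeterTransfer.HartmanWatsonMixture`.

HONEST LABEL: a CONDITIONAL result — the crux item stays OPEN (its own signature is proved only modulo `HartmanWatsonLaw`); what is
unconditional is "Hartman–Watson 1974 ⇒ crux 26809 with c₀ = 2/5".  Nothing about the routes' nodes (`U1HelicityGapTorusD4`,
`AbelianDeconfinementD4`) or any summit statement is proved.  No `sorry`; default heartbeats.  Seat `ym-line-frs-p2` g9 (free hands,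
announced on the owner's bus), `--supports stmt-QuantumFields-26809`.
-/

noncomputable section

namespace Summit.QuantumFields.YangMills.Cruxes.HartmanWatsonMixture

open MeasureTheory
open Literature.Probability.HartmanWatson1974 (IsMixingMeasure HartmanWatsonLaw)

/-- The converse reading of `Tail.isMixingMeasure_of_moments`: a Hartman–Watson mixing measure satisfies the item's integer-moment
clause `(1/π)∫₀^π e^{β cos θ}cos(kθ) dθ = ∫ e^{-k²t/2} dΘ`. -/
theorem moments_of_isMixingMeasure {β : ℝ} {Θ : Measure ℝ} (h : IsMixingMeasure β Θ) (k : ℤ) :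
    ((∫ θ in (0:ℝ)..Real.pi, Real.exp (β * Real.cos θ) * Real.cos (((k : ℤ) : ℝ) * θ)) / Real.pi) =
      ∫ t, Real.exp (-(((k : ℝ) ^ 2) * t) / 2) ∂Θ := by
  have hfun : (fun t => Real.exp (-(((k : ℝ) ^ 2) * t) / 2)) = fun t => Real.exp (-(k : ℝ) ^ 2 * t / 2) := by
    funext t; ring_nf
  rw [hfun, h.laplace k, Literature.Analysis.FunctionSpaces.latticeModels_besselI_eq_besselI_natAbs,
    Literature.Analysis.FunctionSpaces.besselI, div_eq_inv_mul]
  congr 1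
  refine intervalIntegral.integral_congr (fun θ _ => ?_)
  simp only [Tail.cos_intCast_mul k θ]

/-- **`HartmanWatsonLaw →` the registered stub `stub_mixingMeasureExists`** (signature verbatim). -/
theorem stub_mixingMeasureExists_of_law (hHW : HartmanWatsonLaw) :
    ∀ β : ℝ, 0 < β → ∃ Θ : MeasureTheory.Measure ℝ, MeasureTheory.IsFiniteMeasure Θ ∧ Θ (Set.Iic 0) = 0 ∧ (∀ k : ℤ, ((∫ θ in (0:ℝ)..Real.pi, Real.exp (β * Real.cos θ) * Real.cos (((k : ℤ) : ℝ) * θ)) / Real.pi) = ∫ t, Real.exp (-(((k : ℝ) ^ 2) * t) / 2) ∂Θ) := by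
  intro β hβ
  obtain ⟨Θ, hΘ⟩ := hHW β hβ
  exact ⟨Θ, hΘ.finite, hΘ.null_nonpos, moments_of_isMixingMeasure hΘ⟩

/-- **Crux 26809 modulo Hartman–Watson 1974**: `HartmanWatsonLaw → HartmanWatsonMixture` (route `WilsonVillainDualStiffness`, decl by
name), with `c₀ = 2/5` — the registered skeleton's composition with its two analysis stubs LANDED and the existence stub supplied by the
named fact. -/
theorem hartmanWatsonMixture_of_law (hHW : HartmanWatsonLaw) :
    Summit.QuantumFields.YangMills.Theses.WilsonVillainDualStiffness.HartmanWatsonMixture := by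
  obtain ⟨β₀, hβ₀⟩ := Tail.stub_tailFromArcBound ArcMass.stub_arcMassLowerBound
  refine ⟨2 / 5, by norm_num, max β₀ 0, fun β hβ => ?_⟩
  have hpos : 0 < β := lt_of_le_of_lt (le_max_right _ _) hβ
  have hβ' : β₀ < β := lt_of_le_of_lt (le_max_left _ _) hβ
  obtain ⟨Θ, hfin, hsupp, hmom⟩ := stub_mixingMeasureExists_of_law hHW β hpos
  exact ⟨Θ, hfin, hsupp, hmom, hβ₀ β hβ' Θ hfin hsupp hmom⟩

/-- The same for the second route wanting the shared item (`WilsonVillainPerimeterTransfer.HartmanWatsonMixture` has the identical body). -/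
theorem hartmanWatsonMixture_of_law' (hHW : HartmanWatsonLaw) :
    Summit.QuantumFields.YangMills.Theses.WilsonVillainPerimeterTransfer.HartmanWatsonMixture :=
  hartmanWatsonMixture_of_law hHW

end Summit.QuantumFields.YangMills.Cruxes.HartmanWatsonMixture

end
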